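import Summits.QuantumFields.YangMills.Theorems.F4SubCurvatureDoorSubCurvatureClauseDensityTransfer
import Summits.QuantumFields.YangMills.Theorems.LangevinControlUVOSLegsFromFemtoAndGapStubAssemblyLowDegree
import Summits.QuantumFields.YangMills.Theorems.LangevinControlUVOSLegsFromFemtoAndGapStubAssemblyPlaneStringsDefect
import Summits.QuantumFields.YangMills.Theorems.UniversalDetectorMirrorPositivity
import Summits.QuantumFields.YangMills.Theorems.BalabanLadderNTCumulantPolarisationDefs
import HarnessLib

/-!
# Route `F4SubCurvatureDoor`, crux `SubCurvatureClause` ⟨stmt-QuantumFields-23763⟩ — MIXED two-point sums, part 1: the electric shift, reindexed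

Helper file (`--supports stmt-QuantumFields-23763 --as helper`; free-hands seat `ym-line-frs-p2` g19, the «density swap» step of the soft
stub `LatticeToAxis` of the crux idea «rp-moebius-ladder»).  Definition-free, 0 sorry, standard axioms.  Tools for
`Theorems/F4SubCurvatureDoorSubCurvatureClauseMixedTwoPoint.lean`:

* `sum_sub_shift_eq` (§1): reindexing a translated finite sum whose summand vanishes on the boundary layer of the window;
* `covPlane_eq_torusMomentStr` (§2): plane-pair covariances are the length-2 plane-string weights `torusMomentStr` of toolkit VIII/XIV;
* `smul_siteToE_add`, `apply_smul_siteToE_eq_zero`, `exists_coord_ge_of_boundary`, `sum_covPlane_lower_eq` (§3): for a test function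
  supported in `‖·‖ ≤ ρ < aL`, the plane-pair covariances with the second site LOWERED by `e₀`, smeared against `F(a z)` over the window
  `box²`, equal the plane-string weights smeared against `F(a z + a e₀ ⊗ δ₁)`.

[folklore; Glimm–Jaffe 1987 §6.1].  HONEST LABEL: lattice bookkeeping toward a soft stub; ⟨23763⟩ open; the Yang–Mills mass gap is NOT proved;
no summit is proved by a line.
-/

set_option autoImplicit false

noncomputable section

open scoped SchwartzMap BigOperators
open MeasureTheory Filter Topology Metric Set
open Literature.MathematicalPhysics.QuantumFieldTheory Literature.MathematicalPhysics.QuantumLattice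
open Literature.MathematicalPhysics.AQFT
open Literature.Probability.LatticeModels (box Site mem_box)
open Summit.QuantumFields.YangMills.Cruxes.OSLegsFromFemtoAndGap.DlrCollarTransfer
  (dens plane torusE MomentBounds6 continuous_plane continuous_dens)
open Summit.QuantumFields.YangMills.Cruxes.OSLegsAtWeakCouplingC.Sketch (tendsto_riemann_sum)
open Summit.QuantumFields.YangMills.Theorems.OSLegsFromFemtoAndGap
open Summit.QuantumFields.YangMills.Theorems.ROT (IsLegScheme OffDiagLimitAlong)
open Summit.QuantumFields.YangMills.Theorems.NPointIsotropy.Negative (E4)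
open Summit.QuantumFields.YangMills.Cruxes.NT.CumulantPolarisation (torusE_centred_centred)
open Summit.QuantumFields.YangMills.Cruxes.UniversalDetectorPlaneTight
  (cov_dens_mul_dens_cfgReflect_eq_sum cov_dens_eq_sum_cov_plane_univ)

namespace Summit.QuantumFields.YangMills.Theorems.F4SubCurvatureDoorSubCurvatureClauseMixedTwoPointShift

/-! ## §1 Reindexing a translated finite sum -/

/-- **Reindexing a translated sum inside a finite window**: if `g` vanishes at the points that enter or leave the window `S` under the
translation by `δ`, then `Σ_{z ∈ S} g(z − δ) = Σ_{z ∈ S} g(z)`. [bookkeeping] -/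
theorem sum_sub_shift_eq {ι M : Type*} [AddCommGroup ι] [DecidableEq ι] [AddCommMonoid M] (S : Finset ι) (δ : ι) (g : ι → M)
    (h1 : ∀ z ∈ S, z + δ ∉ S → g z = 0) (h2 : ∀ z, z ∉ S → z + δ ∈ S → g z = 0) :
    ∑ z ∈ S, g (z - δ) = ∑ z ∈ S, g z := by
  have hinj : Set.InjOn (fun z : ι => z - δ) S := fun x _ y _ h => by simpa using h
  rw [← Finset.sum_image (f := g) hinj]
  have hmem : ∀ w, w ∈ S.image (fun z => z - δ) ↔ w + δ ∈ S := by
    intro w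
    simp only [Finset.mem_image]
    constructor
    · rintro ⟨z, hz, rfl⟩; simpa using hz
    · intro hw; exact ⟨w + δ, hw, by simp⟩
  -- both sums equal the sum over the intersection
  rw [← Finset.sum_subset (Finset.inter_subset_right : S ∩ S.image (fun z => z - δ) ⊆ _),
    ← Finset.sum_subset (Finset.inter_subset_left : S ∩ S.image (fun z => z - δ) ⊆ S)]
  · intro w hwS hw
    have hwT : w ∉ S.image (fun z => z - δ) := fun h => hw (Finset.mem_inter.2 ⟨hwS, h⟩)
    exact h1 w hwS (fun h => hwT ((hmem w).2 h))
  · intro w hwT hw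
    have hwS : w ∉ S := fun h => hw (Finset.mem_inter.2 ⟨h, hwT⟩)
    exact h2 w hwS ((hmem w).1 hwT)

/-! ## §2 Plane-pair covariances are length-2 plane-string weights -/

variable {G : Type} [Group G] [TopologicalSpace G] [IsTopologicalGroup G] [CompactSpace G]
  [MeasurableSpace G] [BorelSpace G]

/-- **A plane-pair covariance is the length-2 plane-string weight** `torusMomentStr` of toolkit VIII/XIV at the pair of sites.
[bookkeeping] -/
theorem covPlane_eq_torusMomentStr (r : LatticeRep G) (β : ℝ) (L : ℕ) (p q : Fin 4 × Fin 4) (z : Fin 2 → Site 4) :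
    torusE G r β L (fun V => plane G r p (z 0) V * plane G r q (z 1) V) -
        torusE G r β L (plane G r p (z 0)) * torusE G r β L (plane G r q (z 1)) =
      torusMomentStr r.ρ β L (fun i U => plaquetteObs r.ρ 0 ((![p, q] : Fin 2 → Fin 4 × Fin 4) i).1
          ((![p, q] : Fin 2 → Fin 4 × Fin 4) i).2 U)
        (fun i => wilsonTorusMean r.ρ β L (fun U => plaquetteObs r.ρ 0 ((![p, q] : Fin 2 → Fin 4 × Fin 4) i).1
          ((![p, q] : Fin 2 → Fin 4 × Fin 4) i).2 U)) z := by
  rw [← torusE_prod_plane_eq_torusMomentStr r β L (![p, q] : Fin 2 → Fin 4 × Fin 4) z]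
  simp only [Fin.prod_univ_two, Matrix.cons_val_zero, Matrix.cons_val_one]
  rw [torusE_centred_centred G r β L (continuous_plane r p (z 0)) (continuous_plane r q (z 1))]
  ring

/-! ## §3 The mixed smeared sum versus the density two-point lattice distribution -/

omit [TopologicalSpace G] [IsTopologicalGroup G] [CompactSpace G] [BorelSpace G] [Group G] [MeasurableSpace G] in
/-- The scaled lattice points of a multi-site translated by `δ`. [bookkeeping] -/
theorem smul_siteToE_add (a : ℝ) {n : ℕ} (z δ : Fin n → Site 4) :
    (fun l => a • siteToE ((z + δ) l)) = (fun l => a • siteToE (z l)) + fun l => a • siteToE (δ l) := by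
  funext l
  ext i
  simp only [Pi.add_apply, PiLp.add_apply, PiLp.smul_apply, siteToE_apply, Int.cast_add, smul_eq_mul]
  ring

omit [TopologicalSpace G] [IsTopologicalGroup G] [CompactSpace G] [BorelSpace G] [Group G] [MeasurableSpace G] in
/-- A test function supported in `‖·‖ ≤ ρ` vanishes at a scaled multi-site having a coordinate of modulus `≥ L` once `ρ < aL`. [bookkeeping] -/
theorem apply_smul_siteToE_eq_zero {n : ℕ} (F : 𝓢((Fin n → E4), ℂ)) {ρ a : ℝ} {L : ℕ} (ha : 0 ≤ a)
    (hF : tsupport (F : (Fin n → E4) → ℂ) ⊆ closedBall 0 ρ) (hρ : ρ < a * L) (v : Fin n → Site 4)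
    (hv : ∃ l k, (L : ℤ) ≤ |v l k|) : F (fun l => a • siteToE (v l)) = 0 := by
  obtain ⟨l, k, hlk⟩ := hv
  refine image_eq_zero_of_notMem_tsupport fun hmem => ?_
  have h1 : ‖(fun l => a • siteToE (v l))‖ ≤ ρ := by simpa [dist_zero_right] using hF hmem
  have h2 : ‖a • siteToE (v l)‖ ≤ ‖(fun l => a • siteToE (v l))‖ := norm_le_pi_norm (fun l => a • siteToE (v l)) l
  have h3 : |(a • siteToE (v l)) k| ≤ ‖a • siteToE (v l)‖ := by
    simpa [Real.norm_eq_abs] using PiLp.norm_apply_le (a • siteToE (v l)) k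
  have h4 : |(a • siteToE (v l)) k| = a * |((v l k : ℤ) : ℝ)| := by
    rw [PiLp.smul_apply, siteToE_apply, smul_eq_mul, abs_mul, abs_of_nonneg ha]
  have h5 : (L : ℝ) ≤ |((v l k : ℤ) : ℝ)| := by
    rw [← Int.cast_abs]; exact_mod_cast hlk
  have : a * L ≤ a * |((v l k : ℤ) : ℝ)| := mul_le_mul_of_nonneg_left h5 ha
  linarith

omit [TopologicalSpace G] [IsTopologicalGroup G] [CompactSpace G] [BorelSpace G] [Group G] [MeasurableSpace G] in
/-- The boundary layer of the window `box²` under a unit time shift `δ` of the second site: after the shift some coordinate has modulus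
`≥ L`. [bookkeeping] -/
theorem exists_coord_ge_of_boundary {L : ℕ} (δ z : Fin 2 → Site 4) (hδ : ∀ l k, δ l k = if l = 1 ∧ k = 0 then 1 else 0)
    (h : (z ∈ Fintype.piFinset (fun _ : Fin 2 => box 4 L) ∧ z + δ ∉ Fintype.piFinset (fun _ : Fin 2 => box 4 L)) ∨
      (z ∉ Fintype.piFinset (fun _ : Fin 2 => box 4 L) ∧ z + δ ∈ Fintype.piFinset (fun _ : Fin 2 => box 4 L))) :
    ∃ l k, (L : ℤ) ≤ |(z + δ) l k| := by
  simp only [Fintype.mem_piFinset, mem_box, not_forall, not_and_or, not_le] at h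
  rcases h with ⟨hz, ⟨l, k, hlk⟩⟩ | ⟨⟨l, k, hlk⟩, hzδ⟩
  · -- `z` inside, `z + δ` outside at `(l, k)`
    refine ⟨l, k, ?_⟩
    have hzlk := hz l k
    have heq : (z + δ) l k = z l k + δ l k := rfl
    rw [heq, hδ] at hlk ⊢
    rw [le_abs]
    rcases hlk with hlt | hgt
    · right
      split_ifs at hlt ⊢ <;> omega
    · left
      split_ifs at hgt ⊢ <;> omega
  · -- `z` outside at `(l, k)`, `z + δ` inside
    refine ⟨l, k, ?_⟩
    have hz' := hzδ l k
    have heq : (z + δ) l k = z l k + δ l k := rfl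
    rw [heq, hδ] at hz' ⊢
    rw [le_abs]
    rcases hlk with hlt | hgt
    · right
      split_ifs at hz' ⊢ <;> omega
    · left
      split_ifs at hz' ⊢ <;> omega

/-- **The electric shift, reindexed**: for a test function supported in `‖·‖ ≤ ρ < aL`, the plane-pair covariances with the second site
lowered by `e₀`, smeared against `F(a z)` over the window, equal the plane-string weights smeared against `F(a z + a e₀ ⊗ δ₁)`. [bookkeeping] -/
theorem sum_covPlane_lower_eq (r : LatticeRep G) (β : ℝ) (L : ℕ) {a ρ : ℝ} (ha : 0 ≤ a)
    (F : 𝓢((Fin 2 → E4), ℂ)) (hF : tsupport (F : (Fin 2 → E4) → ℂ) ⊆ closedBall 0 ρ) (hρ : ρ < a * L)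
    (p q : Fin 4 × Fin 4) :
    ∑ z ∈ Fintype.piFinset (fun _ : Fin 2 => box 4 L),
        ((torusE G r β L (fun V => plane G r p (z 0) V * plane G r q (z 1 - Pi.single 0 1) V) -
            torusE G r β L (plane G r p (z 0)) * torusE G r β L (plane G r q (z 1 - Pi.single 0 1)) : ℝ) : ℂ) *
          F (fun l => a • siteToE (z l)) =
      ∑ z ∈ Fintype.piFinset (fun _ : Fin 2 => box 4 L),
        ((torusMomentStr r.ρ β L (fun i U => plaquetteObs r.ρ 0 ((![p, q] : Fin 2 → Fin 4 × Fin 4) i).1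
            ((![p, q] : Fin 2 → Fin 4 × Fin 4) i).2 U)
          (fun i => wilsonTorusMean r.ρ β L (fun U => plaquetteObs r.ρ 0 ((![p, q] : Fin 2 → Fin 4 × Fin 4) i).1
            ((![p, q] : Fin 2 → Fin 4 × Fin 4) i).2 U)) z : ℝ) : ℂ) *
          F ((fun l => a • siteToE (z l)) + fun l => a • siteToE ((fun i : Fin 2 => if i = 1 then (Pi.single 0 1 : Site 4) else 0) l)) := by
  classical
  set δ : Fin 2 → Site 4 := fun i => if i = 1 then Pi.single 0 1 else 0 with hδdef
  have hδ : ∀ l k, δ l k = if l = 1 ∧ k = 0 then 1 else 0 := by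
    intro l k
    by_cases hl : l = 1
    · subst hl
      by_cases hk : k = 0
      · subst hk; simp [hδdef]
      · simp [hδdef, hk]
    · simp [hδdef, hl]
  have hδ0 : δ 0 = 0 := by simp [hδdef]
  have hδ1 : δ 1 = Pi.single 0 1 := by simp [hδdef]
  set W : (Fin 2 → Site 4) → ℝ := fun z => torusMomentStr r.ρ β L
      (fun i U => plaquetteObs r.ρ 0 ((![p, q] : Fin 2 → Fin 4 × Fin 4) i).1 ((![p, q] : Fin 2 → Fin 4 × Fin 4) i).2 U)
      (fun i => wilsonTorusMean r.ρ β L (fun U => plaquetteObs r.ρ 0 ((![p, q] : Fin 2 → Fin 4 × Fin 4) i).1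
        ((![p, q] : Fin 2 → Fin 4 × Fin 4) i).2 U)) z with hW
  -- the lowered covariance is the string weight at the translated multi-site
  have key : ∀ z : Fin 2 → Site 4,
      torusE G r β L (fun V => plane G r p (z 0) V * plane G r q (z 1 - Pi.single 0 1) V) -
          torusE G r β L (plane G r p (z 0)) * torusE G r β L (plane G r q (z 1 - Pi.single 0 1)) = W (z - δ) := by
    intro z
    have h := covPlane_eq_torusMomentStr r β L p q (z - δ)
    simp only [Pi.sub_apply, hδ0, hδ1, sub_zero] at h
    rw [h]
  -- reindex
  set g : (Fin 2 → Site 4) → ℂ := fun w => ((W w : ℝ) : ℂ) * F (fun l => a • siteToE ((w + δ) l)) with hg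
  have hlhs : ∀ z : Fin 2 → Site 4,
      ((torusE G r β L (fun V => plane G r p (z 0) V * plane G r q (z 1 - Pi.single 0 1) V) -
          torusE G r β L (plane G r p (z 0)) * torusE G r β L (plane G r q (z 1 - Pi.single 0 1)) : ℝ) : ℂ) *
        F (fun l => a • siteToE (z l)) = g (z - δ) := by
    intro z
    rw [key z, hg]
    simp only [sub_add_cancel]
  have hbd : ∀ w : Fin 2 → Site 4,
      (w ∈ Fintype.piFinset (fun _ : Fin 2 => box 4 L) ∧ w + δ ∉ Fintype.piFinset (fun _ : Fin 2 => box 4 L)) ∨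
        (w ∉ Fintype.piFinset (fun _ : Fin 2 => box 4 L) ∧ w + δ ∈ Fintype.piFinset (fun _ : Fin 2 => box 4 L)) →
      g w = 0 := by
    intro w hw
    rw [hg]
    simp only
    rw [apply_smul_siteToE_eq_zero F ha hF hρ (w + δ) (exists_coord_ge_of_boundary δ w hδ hw), mul_zero]
  calc ∑ z ∈ Fintype.piFinset (fun _ : Fin 2 => box 4 L),
        ((torusE G r β L (fun V => plane G r p (z 0) V * plane G r q (z 1 - Pi.single 0 1) V) -
            torusE G r β L (plane G r p (z 0)) * torusE G r β L (plane G r q (z 1 - Pi.single 0 1)) : ℝ) : ℂ) *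
          F (fun l => a • siteToE (z l))
      = ∑ z ∈ Fintype.piFinset (fun _ : Fin 2 => box 4 L), g (z - δ) := Finset.sum_congr rfl fun z _ => hlhs z
    _ = ∑ z ∈ Fintype.piFinset (fun _ : Fin 2 => box 4 L), g z :=
        sum_sub_shift_eq _ δ g (fun z hz hzδ => hbd z (Or.inl ⟨hz, hzδ⟩)) (fun z hz hzδ => hbd z (Or.inr ⟨hz, hzδ⟩))
    _ = _ := by
        refine Finset.sum_congr rfl fun z _ => ?_
        rw [hg]
        simp only
        rw [smul_siteToE_add]

end Summit.QuantumFields.YangMills.Theorems.F4SubCurvatureDoorSubCurvatureClauseMixedTwoPointShift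

end
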